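import Summits.NavierStokesRegularity.NavierStokesRegularity.Theorems.StrongHypothesesLerayHopfHHalfBoundBridge
import Literature.Analysis.FunctionSpaces.FourierSobolevNormProofs
import HarnessLib

/-!
# Bridge `L^∞_t H^{1/2}_x` (inhomogeneous) bound for Leray–Hopf solutions ⇒ Clay (A)

Companion of `Theorems/StrongHypothesesLerayHopfHHalfBoundBridge.lean`
(`navierStokesRegularity_of_lerayHopfHomSobolevHalfBound`: an a.e.-in-time bound of the
HOMOGENEOUS seminorm `‖u(t)‖_{Ḣ^{1/2}}` of every Leray–Hopf weak solution from a Clay datum implies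
Fefferman's (A)). This file records the same implication for the INHOMOGENEOUS norm
`‖u(t)‖_{H^{1/2}}` — the literal form "`u ∈ L^∞(0,T; H^{1/2}(ℝ³))`" in which claimed regularity
theorems of the harmonic-analysis family are printed (cell `ns-claims`, D-0090, claim C08) — via
`‖f‖_{Ḣ^s} ≤ ‖f‖_{H^s}` for `s ≥ 0` (Bahouri–Chemin–Danchin 2011, §1.4.1; PROVED in the tree:
`Literature.Analysis.FunctionSpaces.eHomSobolevSeminorm_le_holds`). Only the classical implication
"that statement ⇒ (A)" is asserted (ESS 2003 + Sobolev); the hypothesis itself is open.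

WHAT THIS IS NOT: not a claim about NS regularity or blow-up; not a claim about any author beyond the typed locator.

## References

* H. Bahouri, J.-Y. Chemin, R. Danchin, *Fourier Analysis and Nonlinear PDE* (2011), §1.4.1 and
  Thm. 1.38. [`BahouriCheminDanchin2011`]
* L. Escauriaza, G. Seregin, V. Šverák, Russ. Math. Surveys 58 (2003), Thms. 1.3–1.4.
  [`EscauriazaSereginSverak2003`]
-/

noncomputable section

namespace Summit.NavierStokesRegularity.StrongHypotheses

open Set MeasureTheory Filter
open scoped ENNReal NNReal ContDiff
open Literature.Analysis.FluidPDE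
open Literature.Analysis.FunctionSpaces.EuclideanSpace (complexify)
open Literature.StrongHypotheses.NavierStokesRegularity

/-- `‖f‖_{Ḣ^s} ≤ ‖f‖_{H^s}` for `s ≥ 0` at the function level (`Function.eHomSobolevSeminorm` vs
`Function.eSobolevNorm`; both are `∞` off `L²`): the tree's discharged `eHomSobolevSeminorm_le_holds`
(Bahouri–Chemin–Danchin 2011, §1.4.1) read through the `L²` guard. [cite: BahouriCheminDanchin2011, §1.4.1] -/
theorem eHomSobolevSeminorm_le_eSobolevNorm {E F : Type*} [NormedAddCommGroup E]
    [InnerProductSpace ℝ E] [FiniteDimensional ℝ E] [MeasurableSpace E] [BorelSpace E]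
    [NormedAddCommGroup F] [InnerProductSpace ℂ F] [CompleteSpace F]
    {s : ℝ} (hs : 0 ≤ s) (f : E → F) :
    Function.eHomSobolevSeminorm s f ≤ Function.eSobolevNorm s f := by
  unfold Function.eHomSobolevSeminorm Function.eSobolevNorm
  by_cases h : MemLp f 2 (volume : Measure E)
  · rw [dif_pos h, dif_pos h]
    exact Literature.Analysis.FunctionSpaces.eHomSobolevSeminorm_le_holds hs _
  · rw [dif_neg h, dif_neg h]

/-- **`L^∞_t H^{1/2}_x` bound for all Leray–Hopf solutions from Clay data ⇒ Clay (A)**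
(inhomogeneous form). If every Leray–Hopf weak solution of the unforced Navier–Stokes system on
`ℝ³ × [0,T)` from a smooth, divergence-free, rapidly decaying datum obeys an a.e.-in-time bound of
its `H^{1/2}(ℝ³)` norm (`Function.eSobolevNorm (1/2)` of `complexify ∘ u t`), then Fefferman's Clay
statement (A) holds — by `‖·‖_{Ḣ^{1/2}} ≤ ‖·‖_{H^{1/2}}` and
`navierStokesRegularity_of_lerayHopfHomSobolevHalfBound` (Sobolev `Ḣ^{1/2} ↪ L³` + ESS 2003).
The hypothesis is OPEN; only the implication is asserted. [cite: EscauriazaSereginSverak2003, Thm. 1.4] -/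
theorem navierStokesRegularity_of_lerayHopfSobolevHalfBound
    (H : ∀ (ν T : ℝ), 0 < ν → 0 < T →
      ∀ (u₀ : EuclideanSpace ℝ (Fin 3) → EuclideanSpace ℝ (Fin 3))
        (u : ℝ → EuclideanSpace ℝ (Fin 3) → EuclideanSpace ℝ (Fin 3)),
      ContDiff ℝ ∞ u₀ → NSWave0.IsDivFree u₀ → HasRapidSpatialDecay u₀ →
      IsLerayHopfOn T ν 0 u₀ u →
        ∃ M : ℝ≥0, ∀ᵐ t ∂(volume.restrict (Ioo 0 T)),
          Function.eSobolevNorm (1 / 2 : ℝ) (complexify ∘ u t) ≤ M) :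
    _root_.NavierStokesRegularity := by
  refine navierStokesRegularity_of_lerayHopfHomSobolevHalfBound fun ν T hν hT u₀ u hs hd hdec hLH => ?_
  obtain ⟨M, hM⟩ := H ν T hν hT u₀ u hs hd hdec hLH
  refine ⟨M, hM.mono fun t ht => ?_⟩
  exact (eHomSobolevSeminorm_le_eSobolevNorm (by norm_num) _).trans ht

end Summit.NavierStokesRegularity.StrongHypotheses

end
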